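import Summits.BirchSwinnertonDyer.BirchSwinnertonDyer.Theses.ResidualThetaTransportAtTwo
import HarnessLib

/-!
CERTIFICATE (rtt-p2 g8, evidence only — not a proposal): the candidate restatement (R≥) of RTC≥
`ResidualThetaCountLowerAtTwo` (stmt-BirchSwinnertonDyer-25435) / the ≥ half of RMC `ResidualThetaCountAtTwo` (24195).

* `RgeShort` — ITEM TEXT for the pen (≤ 4000 chars, the `open … in` short form of the route file; = 25435's text with the
  premise `∀ c : ℕ, (∀ E …, … = 2 ^ (… + c)) →` DELETED and `+ c` DELETED in the conclusion; 2592 chars);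
* `rgeShort_iff_long : RgeShort ↔ <the fully-qualified hypothesis `hRge` of the proposed Theorems file
  ResidualThetaTransportAtTwoResidualThetaMainConjectureAtTwoOfResidualLower.lean>` := Iff.rfl;
* `rge_of_items : ResidualLambdaFormulaNegDiscAtTwo → ResidualThetaCountLowerAtTwo → RgeShort` (re-proved here so the
  certificate is self-contained; same proof as `residualLower_of_residualLambdaFormula_of_countLower`);
* `low_of_count : ResidualThetaCountAtTwo → ResidualThetaCountLowerAtTwo` (24195 ⟹ 25435, `.ge`).
BSD is not proved by any of this.
-/

set_option autoImplicit false
set_option linter.dupNamespace false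

noncomputable section

open scoped Classical

namespace RTTP2G8Cert

open Literature

/-- (R≥) — candidate item text (short form). -/
def RgeShort : Prop :=
  open NumberTheory.EllipticCurves in open Kobayashi2003 GreenbergVatsal2000 ModularForms Rank1Residual GreenbergSelmer IsDedekindDomain NumberField AddSubgroup Field PowerSeries Rat.HeightOneSpectrum in ∀ (W : WeierstrassCurve ℚ) [W.IsElliptic] [W.IsGloballyMinimal], ¬ W.HasCM → W.analyticRank = 0 → GoodSS W 2 → W.frobeniusTrace 2 = 0 → W.Δ < 0 → ∀ (M : ℕ) [NeZero M] (g : CuspForm (CongruenceSubgroup.Gamma0 M) 2) (ι : coeffField g →+* PadicAlgCl 2) (Ω : ℂ), Odd M → IsNewform0 g → Literature.NumberTheory.Automorphic.IsCMForm (liftToGamma1 M 2 g) → cuspCoeff g 2 = 0 → IsCohomologicalPlusPeriod g ι Ω → (∀ ℓ : ℕ, ℓ.Prime → ¬ ℓ ∣ 2 * M * W.conductorNorm ℤ → ‖embCoeff g ι ℓ - (W.frobeniusTrace ℓ : PadicAlgCl 2)‖ < 1) → ∀ (κ : ZpExtension ℚ 2) (γ : absoluteGaloisGroup ℚ), κ.IsCyclotomic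 → κ.IsTopGenerator γ → IsCyclotomicVariable 2 γ → ∀ (S₀ : Finset (HeightOneSpectrum (RingOfIntegers ℚ))), (∀ v ∈ S₀, ((2 : ℕ) : RingOfIntegers ℚ) ∉ v.asIdeal) → (∀ v : HeightOneSpectrum (RingOfIntegers ℚ), ¬ W.HasGoodReductionAt v → v ∈ S₀) → (∀ v : HeightOneSpectrum (RingOfIntegers ℚ), natGenerator v ∣ M → v ∈ S₀) → ∀ (D : SignedSelmerDualData W κ γ 1) [Module.Finite (IwasawaAlgebra 2) D.X], Module.IsTorsion (IwasawaAlgebra 2) D.X → D.mu = 0 → ∀ (Lp Lm : IwasawaAlgebraO (Set.range ι)) (d : ℕ), IsPollackPairK g ι Ω Lp Lm → (∀ k : ℕ, ‖coeff k (iwasawaOToPowerSeries (Set.range ι) Lm)‖ ≤ ‖coeff d (iwasawaOToPowerSeries (Set.range ι) Lm)‖) → (∀ k : ℕ, k < d → ‖coeff k (iwasawaOToPowerSeries (Set.range ι) Lm)‖ < ‖coeff d (iwasawaOToPowerSeries (Set.range ι) Lm)‖) → 2 ^ (d + (∑ v ∈ S₀, 2 ^ padicValNat 2 ((natGenerator v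 ^ 2 - 1) / 8) * (if natGenerator v ∣ M then (if ‖embCoeff g ι (natGenerator v) - 1‖ < 1 then 1 else 0) else (if ‖embCoeff g ι (natGenerator v)‖ < 1 then 2 else 0)))) ≤ {x : subgroupH1 κ.kerSubgroup ↥(torsionBy ↥(W.geomPrimaryTorsion 2) (2 : ℤ)) | x ∈ unramifiedOutside κ.kerSubgroup ↥(torsionBy ↥(W.geomPrimaryTorsion 2) (2 : ℤ)) 2 (↑S₀ : Set (HeightOneSpectrum (RingOfIntegers ℚ))) ∧ (∀ (w : InfinitePlace ℚ) (σ : absoluteGaloisGroup ℚ), conjH1 κ.kerSubgroup ↥(torsionBy ↥(W.geomPrimaryTorsion 2) (2 : ℤ)) σ x ∈ infKer κ.kerSubgroup ↥(torsionBy ↥(W.geomPrimaryTorsion 2) (2 : ℤ)) w) ∧ (∀ (v : HeightOneSpectrum (RingOfIntegers ℚ)), ((2 : ℕ) : RingOfIntegers ℚ) ∈ v.asIdeal → ∀ σ : absoluteGaloisGroup ℚ, W.conjH1 2 κ.kerSubgroup σ (pushH1 κ.kerSubgroup (torsionBy ↥(W.geomPrimaryTorsion 2) (2 : ℤ)).subtype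 (fun _ _ ↦ rfl) x) ∈ localKummerOverOfEmb W 2 κ.kerSubgroup (closureEmb (K := ℚ) (v.adicCompletion ℚ)) (⨆ n : ℕ, signedLocalPoints κ (v.adicCompletion ℚ) W 1 n))}.ncard

/-- short form ↔ fully-qualified long form (the `hRge` hypothesis of the g8 Theorems file). -/
theorem rgeShort_iff_long : RgeShort ↔ (∀ (W : WeierstrassCurve ℚ) [W.IsElliptic] [W.IsGloballyMinimal], ¬ W.HasCM → W.analyticRank = 0 → Literature.NumberTheory.EllipticCurves.Rank1Residual.GoodSS W 2 → W.frobeniusTrace 2 = 0 → W.Δ < 0 → ∀ (M : ℕ) [NeZero M] (g : CuspForm (CongruenceSubgroup.Gamma0 M) 2) (ι : Literature.NumberTheory.EllipticCurves.ModularForms.coeffField g →+* PadicAlgCl 2) (Ω : ℂ), Odd M → Literature.NumberTheory.EllipticCurves.ModularForms.IsNewform0 g → Literature.NumberTheory.Automorphic.IsCMForm (Literature.NumberTheory.EllipticCurves.ModularForms.liftToGamma1 M 2 g) → Literature.NumberTheory.EllipticCurves.ModularForms.cuspCoeff g 2 = 0 → Literature.NumberTheory.EllipticCurves.IsCohomologicalPlusPeriod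 g ι Ω → (∀ ℓ : ℕ, ℓ.Prime → ¬ ℓ ∣ 2 * M * W.conductorNorm ℤ → ‖Literature.NumberTheory.EllipticCurves.embCoeff g ι ℓ - (W.frobeniusTrace ℓ : PadicAlgCl 2)‖ < 1) → ∀ (κ : Literature.NumberTheory.EllipticCurves.ZpExtension ℚ 2) (γ : Field.absoluteGaloisGroup ℚ), κ.IsCyclotomic → κ.IsTopGenerator γ → Literature.NumberTheory.EllipticCurves.IsCyclotomicVariable 2 γ → ∀ (S₀ : Finset (IsDedekindDomain.HeightOneSpectrum (NumberField.RingOfIntegers ℚ))), (∀ v ∈ S₀, ((2 : ℕ) : NumberField.RingOfIntegers ℚ) ∉ v.asIdeal) → (∀ v : IsDedekindDomain.HeightOneSpectrum (NumberField.RingOfIntegers ℚ), ¬ W.HasGoodReductionAt v → v ∈ S₀) → (∀ v : IsDedekindDomain.HeightOneSpectrum (NumberField.RingOfIntegers ℚ), Rat.HeightOneSpectrum.natGenerator v ∣ M → v ∈ S₀) → ∀ (D : Literature.NumberTheory.EllipticCurves.Kobayashi2003.SignedSelmerDualData W κ γ 1) [Module.Finite (Literature.NumberTheory.EllipticCurves.IwasawaAlgebra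 2) D.X], Module.IsTorsion (Literature.NumberTheory.EllipticCurves.IwasawaAlgebra 2) D.X → D.mu = 0 → ∀ (Lp Lm : Literature.NumberTheory.EllipticCurves.IwasawaAlgebraO (Set.range ι)) (d : ℕ), Literature.NumberTheory.EllipticCurves.IsPollackPairK g ι Ω Lp Lm → (∀ k : ℕ, ‖PowerSeries.coeff k (Literature.NumberTheory.EllipticCurves.iwasawaOToPowerSeries (Set.range ι) Lm)‖ ≤ ‖PowerSeries.coeff d (Literature.NumberTheory.EllipticCurves.iwasawaOToPowerSeries (Set.range ι) Lm)‖) → (∀ k : ℕ, k < d → ‖PowerSeries.coeff k (Literature.NumberTheory.EllipticCurves.iwasawaOToPowerSeries (Set.range ι) Lm)‖ < ‖PowerSeries.coeff d (Literature.NumberTheory.EllipticCurves.iwasawaOToPowerSeries (Set.range ι) Lm)‖) → 2 ^ (d + (∑ v ∈ S₀, 2 ^ padicValNat 2 ((Rat.HeightOneSpectrum.natGenerator v ^ 2 - 1) / 8) * (if Rat.HeightOneSpectrum.natGenerator v ∣ M then (if ‖Literature.NumberTheory.EllipticCurves.embCoeff g ι (Rat.HeightOneSpectrum.natGenerator v)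 - 1‖ < 1 then 1 else 0) else (if ‖Literature.NumberTheory.EllipticCurves.embCoeff g ι (Rat.HeightOneSpectrum.natGenerator v)‖ < 1 then 2 else 0)))) ≤ {x : Literature.NumberTheory.EllipticCurves.subgroupH1 κ.kerSubgroup ↥(AddSubgroup.torsionBy ↥(W.geomPrimaryTorsion 2) (2 : ℤ)) | x ∈ Literature.NumberTheory.EllipticCurves.GreenbergVatsal2000.unramifiedOutside κ.kerSubgroup ↥(AddSubgroup.torsionBy ↥(W.geomPrimaryTorsion 2) (2 : ℤ)) 2 (↑S₀ : Set (IsDedekindDomain.HeightOneSpectrum (NumberField.RingOfIntegers ℚ))) ∧ (∀ (w : NumberField.InfinitePlace ℚ) (σ : Field.absoluteGaloisGroup ℚ), Literature.NumberTheory.EllipticCurves.conjH1 κ.kerSubgroup ↥(AddSubgroup.torsionBy ↥(W.geomPrimaryTorsion 2) (2 : ℤ)) σ x ∈ Literature.NumberTheory.EllipticCurves.GreenbergSelmer.infKer κ.kerSubgroup ↥(AddSubgroup.torsionBy ↥(W.geomPrimaryTorsion 2) (2 : ℤ)) w) ∧ (∀ (v : IsDedekindDomain.HeightOneSpectrum (NumberField.RingOfIntegers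 ℚ)), ((2 : ℕ) : NumberField.RingOfIntegers ℚ) ∈ v.asIdeal → ∀ σ : Field.absoluteGaloisGroup ℚ, W.conjH1 2 κ.kerSubgroup σ (Literature.NumberTheory.EllipticCurves.GreenbergVatsal2000.pushH1 κ.kerSubgroup (AddSubgroup.torsionBy ↥(W.geomPrimaryTorsion 2) (2 : ℤ)).subtype (fun _ _ ↦ rfl) x) ∈ Literature.NumberTheory.EllipticCurves.Kobayashi2003.localKummerOverOfEmb W 2 κ.kerSubgroup (Literature.NumberTheory.EllipticCurves.closureEmb (K := ℚ) (v.adicCompletion ℚ)) (⨆ n : ℕ, Literature.NumberTheory.EllipticCurves.Kobayashi2003.signedLocalPoints κ (v.adicCompletion ℚ) W 1 n))}.ncard) := Iff.rfl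

/-- (R≥) ⟸ RLF (23110) ∧ RTC≥ (25435). -/
theorem rge_of_items (hRLF : Summit.BirchSwinnertonDyer.BirchSwinnertonDyer.Theses.ResidualThetaTransportAtTwo.ResidualLambdaFormulaNegDiscAtTwo) (hLow : Summit.BirchSwinnertonDyer.BirchSwinnertonDyer.Theses.ResidualThetaTransportAtTwo.ResidualThetaCountLowerAtTwo) :
    RgeShort := by
  intro W _ _ hcm hr hss ha hΔ M _ g ι Ω hodd hnew hcmg ha2 hΩ hcong κ γ hκ hγ hcv S₀ hS2 hSW hSM D _ hX hμ Lp Lm d hPK hd1 hd2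
  obtain ⟨c, hc⟩ := hRLF κ γ hκ hγ S₀ hS2
  have h2 := hLow W hcm hr hss ha hΔ M g ι Ω hodd hnew hcmg ha2 hΩ hcong κ γ hκ hγ hcv S₀ hS2 hSW hSM D hX hμ Lp Lm d hPK
    hd1 hd2 c (fun E _ _ hssE haE hΔE hSE D' _ hXE hμE ↦ hc E hssE haE hΔE hSE D' hXE hμE)
  exact le_trans (Nat.pow_le_pow_right (by norm_num) (Nat.le_add_right _ c)) h2

/-- 24195 ⟹ 25435. -/
theorem low_of_count (h : Summit.BirchSwinnertonDyer.BirchSwinnertonDyer.Theses.ResidualThetaTransportAtTwo.ResidualThetaCountAtTwo) : Summit.BirchSwinnertonDyer.BirchSwinnertonDyer.Theses.ResidualThetaTransportAtTwo.ResidualThetaCountLowerAtTwo := by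
  intro W _ _ hcm hr hss ha hΔ M _ g ι Ω hodd hnew hcmg ha2 hΩ hcong κ γ hκ hγ hcv S₀ hS2 hSW hSM D _ hX hμ Lp Lm d hPK hd1 hd2
    c hP
  exact (h W hcm hr hss ha hΔ M g ι Ω hodd hnew hcmg ha2 hΩ hcong κ γ hκ hγ hcv S₀ hS2 hSW hSM D hX hμ Lp Lm d hPK hd1 hd2
    c hP).ge

end RTTP2G8Cert
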